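import Literature.NumberTheory.Automorphic.HaarIntegralClosedCompactProofs
import Literature.NumberTheory.Automorphic.HaarConjCompact
import Literature.NumberTheory.Automorphic.JacquetModuleProofs
import HarnessLib

/-!
# The invariant integral on `Ind_H^G δ_H`: `h ↦ ∫_K h(k) dk` is right `G`-invariant for `G = H K`

Topic `NumberTheory/Automorphic` (next to `HaarIntegralClosedCompactProofs`); theorems only (no
definition, no named fact). Let `G` be a second countable locally compact Hausdorff UNIMODULAR group
(its left Haar measure `μ_G` is right invariant), `H ≤ G` a closed subgroup and `K ≤ G` a compact OPEN
subgroup with `G = H K` (an Iwasawa decomposition). For a continuous function `h : G → ℂ` in the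
induced space of the modular character of `H`, i.e. `h(p x) = Δ_H(p) h(x)` for `p ∈ H`
(`Δ_H` = Mathlib's `modularCharacter` of `↥H`, `map (· * p) μ_H = Δ_H(p) • μ_H`), the integral over `K`
is right `G`-invariant:

* `integral_subgroup_comp_mul_right_eq` — `∫_K h(k g) dμ_K(k) = ∫_K h(k) dμ_K(k)` for every `g ∈ G`.

This is the `G`-invariant "integral over `H \\ G`" on the space of `δ_H`-densities (Bernstein–Zelevinsky
1976, 1.21; 1977, 1.9 (c); Bump 1997, §4.4 and Prop. 2.1.5-type "`dg = d_ℓh dk`"), the source of the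
invariant inner product on an induced representation `Ind_H^G(χ δ_H^{1/2})`, `χ` unitary. Proof: by
`HaarHK.eq_smul_map_prod` (`μ_G = c · (h,k) ↦ h k⁻¹)_*(μ_H ⊗ μ_K)`) and Fubini,
`∫_G ψ dμ_G = c ∫_K (∫_H ψ(p k) dμ_H(p)) dμ_K(k)` for the compactly supported function
`ψ(x) = 1_K(x g) h(x g)`; the inner integral is `μ_H(H ∩ K) · h(k g)` (write `k g = p₁ k₁`; on the
support `p p₁ ∈ K`, so `Δ_H(p) = Δ_H(p₁)⁻¹`, and `μ_H{p : p p₁ ∈ K} = Δ_H(p₁) μ_H(H ∩ K)` by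
`DeltaCharBorel.measure_preimage_mul_right_eq_modularCharacter_mul`); and `∫_G ψ dμ_G` does not depend
on `g` by right invariance of `μ_G`.

## References

* I. N. Bernstein, A. V. Zelevinsky, *Representations of the group GL(n, F) where F is a
  non-archimedean local field*, Russian Math. Surveys 31:3 (1976), 1.18–1.21. [BernsteinZelevinskyRMS1976]
* I. N. Bernstein, A. V. Zelevinsky, *Induced representations of reductive `p`-adic groups I*,
  Ann. Sci. ÉNS 10 (1977), 1.7–1.9. [BernsteinZelevinskyASENS1977]
* A. Deitmar, S. Echterhoff, *Principles of Harmonic Analysis* (2014), Prop. 1.5.6. [DeitmarEchterhoff2014]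
-/

noncomputable section

open MeasureTheory Measure Set Filter Topology Function
open scoped ENNReal NNReal Pointwise

namespace Literature.NumberTheory.Automorphic

universe u

variable {G : Type u} [Group G] [TopologicalSpace G] [IsTopologicalGroup G] [LocallyCompactSpace G]
  [T2Space G] [SecondCountableTopology G] [MeasurableSpace G] [BorelSpace G]
  {H K : Subgroup G} [LocallyCompactSpace ↥H]

omit [LocallyCompactSpace G] [T2Space G] [SecondCountableTopology G] in
/-- **The fibre integral of the test function `x ↦ 1_K(x g) h(x g)` over `H`** equals
`μ_H(H ∩ K) · h(k g)` at `x = k ∈ K`, for `h` in the induced space of `Δ_H` and `K` compact open,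
`G = H K`. [cite: BernsteinZelevinskyRMS1976, 1.21] -/
theorem integral_subgroup_indicator_mul_eq (hH : IsClosed (H : Set G)) (hKo : IsOpen (K : Set G))
    (hKc : IsCompact (K : Set G)) (hHK : ∀ g : G, ∃ p ∈ H, ∃ k ∈ K, g = p * k)
    (μH : Measure ↥H) [IsHaarMeasure μH]
    (h : G → ℂ) (hmod : ∀ (p : ↥H) (x : G), h ((p : G) * x) = ((modularCharacter p : ℝ≥0) : ℂ) * h x)
    (g : G) (k : G) :
    ∫ p : ↥H, (K : Set G).indicator h ((p : G) * (k * g)) ∂μH =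
      (μH.real {p : ↥H | (p : G) ∈ (K : Set G)}) * h (k * g) := by
  -- `k g = p₁ k₁`
  obtain ⟨p₁, hp₁, k₁, hk₁, hkg⟩ := hHK (k * g)
  -- the set `S = {p : p p₁ ∈ K}` and its measure
  set S : Set ↥H := {p : ↥H | (p : G) * p₁ ∈ (K : Set G)} with hS
  have hHK₀ : IsOpen {p : ↥H | (p : G) ∈ (K : Set G)} := hKo.preimage continuous_subtype_val
  have hS_eq : S = (fun p : ↥H => p * ⟨p₁, hp₁⟩) ⁻¹' {p : ↥H | (p : G) ∈ (K : Set G)} := by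
    ext p; simp [hS]
  have hμS : μH S = modularCharacter (⟨p₁, hp₁⟩ : ↥H) * μH {p : ↥H | (p : G) ∈ (K : Set G)} := by
    rw [hS_eq]
    exact DeltaCharBorel.measure_preimage_mul_right_eq_modularCharacter_mul μH hHK₀ _
  -- the modular character on the support: `Δ(p) = Δ(p₁)⁻¹`
  have hΔK : ∀ q : ↥H, (q : G) ∈ (K : Set G) → modularCharacter q = 1 := by
    intro q hq
    have hc : IsCompact ((K.subgroupOf H : Subgroup ↥H) : Set ↥H) :=
      hH.isClosedEmbedding_subtypeVal.isCompact_preimage hKc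
    exact modularCharacter_eq_one_of_mem_isCompact hc (Subgroup.mem_subgroupOf.2 hq)
  have hΔS : ∀ p : ↥H, p ∈ S → ((modularCharacter p : ℝ≥0) : ℂ) * ((modularCharacter (⟨p₁, hp₁⟩ : ↥H) : ℝ≥0) : ℂ) = 1 := by
    intro p hp
    rw [← Complex.ofReal_mul, ← NNReal.coe_mul, ← map_mul, hΔK (p * ⟨p₁, hp₁⟩) (by exact hp), NNReal.coe_one,
      Complex.ofReal_one]
  -- the integrand is `S.indicator (const (h k₁))`
  have hfun : (fun p : ↥H => (K : Set G).indicator h ((p : G) * (k * g))) =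
      S.indicator (fun _ => h k₁) := by
    funext p
    rw [hkg, ← mul_assoc]
    by_cases hp : p ∈ S
    · rw [Set.indicator_of_mem hp, Set.indicator_of_mem (show (p : G) * p₁ * k₁ ∈ (K : Set G) from
        K.mul_mem hp hk₁)]
      -- `h(p p₁ k₁) = Δ(p) Δ(p₁) h(k₁)` and `h(p₁ k₁) = Δ(p₁) h(k₁)`
      have e1 : h ((p : G) * p₁ * k₁) = ((modularCharacter p : ℝ≥0) : ℂ) *
          (((modularCharacter (⟨p₁, hp₁⟩ : ↥H) : ℝ≥0) : ℂ) * h k₁) := by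
        rw [mul_assoc, hmod p, show p₁ * k₁ = ((⟨p₁, hp₁⟩ : ↥H) : G) * k₁ from rfl, hmod]
      rw [e1, ← mul_assoc, hΔS p hp, one_mul]
    · rw [Set.indicator_of_notMem hp, Set.indicator_of_notMem]
      exact fun h' => hp (by
        have : (p : G) * p₁ * k₁ * k₁⁻¹ ∈ (K : Set G) := K.mul_mem h' (K.inv_mem hk₁)
        rwa [mul_inv_cancel_right] at this)
  have hSm : MeasurableSet S := by
    rw [hS_eq]; exact (hHK₀.preimage (continuous_id.mul continuous_const)).measurableSet
  rw [hfun, integral_indicator_const _ hSm, Measure.real, hμS, ENNReal.toReal_mul, ENNReal.coe_toReal, hkg,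
    show p₁ * k₁ = ((⟨p₁, hp₁⟩ : ↥H) : G) * k₁ from rfl, hmod, Complex.real_smul, Complex.ofReal_mul, Measure.real]
  ring

/-- **The invariant integral on `Ind_H^G δ_H`.** For a unimodular second countable locally compact group
`G = H K` (`H` closed, `K` compact open) and a continuous `h : G → ℂ` with `h(p x) = Δ_H(p) h(x)`
(`p ∈ H`), the functional `h ↦ ∫_K h dμ_K` is right `G`-invariant:
`∫_K h(k g) dμ_K(k) = ∫_K h(k) dμ_K(k)`. [cite: BernsteinZelevinskyRMS1976, 1.21] -/
theorem integral_subgroup_comp_mul_right_eq (hH : IsClosed (H : Set G)) (hKo : IsOpen (K : Set G))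
    (hKc : IsCompact (K : Set G)) (hHK : ∀ g : G, ∃ p ∈ H, ∃ k ∈ K, g = p * k)
    (μG : Measure G) [IsHaarMeasure μG] [μG.IsMulRightInvariant] (μK : Measure ↥K) [IsHaarMeasure μK]
    (h : G → ℂ) (hcont : Continuous h)
    (hmod : ∀ (p : ↥H) (x : G), h ((p : G) * x) = ((modularCharacter p : ℝ≥0) : ℂ) * h x) (g : G) :
    ∫ k : ↥K, h ((k : G) * g) ∂μK = ∫ k : ↥K, h (k : G) ∂μK := by
  haveI : CompactSpace ↥K := isCompact_iff_compactSpace.1 hKc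
  haveI : SecondCountableTopology ↥H := TopologicalSpace.Subtype.secondCountableTopology (H : Set G)
  haveI : SecondCountableTopology ↥K := TopologicalSpace.Subtype.secondCountableTopology (K : Set G)
  haveI := isInvInvariant_of_compactSpace μK
  set μH : Measure ↥H := Measure.haar with hμH
  -- the test functions `ψ_{g₀}(x) = 1_K(x g₀) h(x g₀)` and their integrals over `G`
  set ψ : G → G → ℂ := fun g₀ x => (K : Set G).indicator h (x * g₀) with hψ
  have hψint : ∀ g₀, Integrable (ψ g₀) μG := by
    intro g₀
    have hset : IsCompact ((fun x : G => x * g₀) ⁻¹' (K : Set G)) := by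
      have : (fun x : G => x * g₀) ⁻¹' (K : Set G) = (fun y : G => y * g₀⁻¹) '' (K : Set G) := by
        ext x
        simp only [Set.mem_preimage, Set.mem_image]
        constructor
        · intro hx; exact ⟨x * g₀, hx, by rw [mul_inv_cancel_right]⟩
        · rintro ⟨y, hy, rfl⟩; rwa [inv_mul_cancel_right]
      rw [this]
      exact hKc.image (continuous_id.mul continuous_const)
    have heq : ψ g₀ = ((fun x : G => x * g₀) ⁻¹' (K : Set G)).indicator (fun x => h (x * g₀)) := by
      funext x
      exact (Set.indicator_comp_right (fun x : G => x * g₀)).symm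
    rw [heq]
    exact (((hcont.comp (continuous_id.mul continuous_const)).continuousOn).integrableOn_compact
      hset).integrable_indicator (hKo.preimage (continuous_id.mul continuous_const)).measurableSet
  -- `∫_G ψ_{g₀} = c · C · ∫_K h(k g₀)`
  have hformula : ∀ g₀, ∫ x, ψ g₀ x ∂μG =
      (HaarHK.decompConst hH hKc hHK μG μH μK : ℝ) * ((μH.real {p : ↥H | (p : G) ∈ (K : Set G)}) *
        ∫ k : ↥K, h ((k : G) * g₀) ∂μK) := by
    intro g₀
    -- the measure identity and Fubini (in the order `∫_K ∫_H`)
    set c : ℝ≥0∞ := (HaarHK.decompConst hH hKc hHK μG μH μK : ℝ≥0∞) with hc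
    set ρ : Measure G := Measure.map (HaarHK.hkMap H K) (μH.prod μK) with hρ
    have hmeas : Measurable (HaarHK.hkMap H K) := HaarHK.continuous_hkMap.measurable
    have hμ : μG = c • ρ := HaarHK.eq_smul_map_prod hH hKc hHK μG μH μK
    have hc0 : c ≠ 0 := by
      rw [hc, ne_eq, ENNReal.coe_eq_zero]
      exact (HaarHK.decompConst_pos hH hKc hHK μG μH μK).ne'
    have hfρ : Integrable (ψ g₀) ρ := by
      have h1 : Integrable (ψ g₀) (c • ρ) := by rw [← hμ]; exact hψint g₀
      exact (integrable_smul_measure hc0 ENNReal.coe_ne_top).1 h1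
    have hfm : AEStronglyMeasurable (ψ g₀) (Measure.map (HaarHK.hkMap H K) (μH.prod μK)) := hfρ.1
    have hint : Integrable (fun q : ↥H × ↥K => ψ g₀ (HaarHK.hkMap H K q)) (μH.prod μK) :=
      (integrable_map_measure hfm hmeas.aemeasurable).1 hfρ
    calc ∫ x, ψ g₀ x ∂μG = ∫ x, ψ g₀ x ∂(c • ρ) := by rw [← hμ]
      _ = c.toReal • ∫ x, ψ g₀ x ∂ρ := integral_smul_measure _ c
      _ = c.toReal • ∫ q, ψ g₀ (HaarHK.hkMap H K q) ∂(μH.prod μK) := by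
          rw [hρ, integral_map hmeas.aemeasurable hfm]
      _ = c.toReal • ∫ k, ∫ p, ψ g₀ (HaarHK.hkMap H K (p, k)) ∂μH ∂μK := by rw [integral_prod_symm _ hint]
      _ = c.toReal • ∫ k : ↥K, (μH.real {p : ↥H | (p : G) ∈ (K : Set G)}) * h ((k : G) * g₀) ∂μK := by
          congr 1
          -- `∫_H ψ(p k⁻¹) dp = C · h(k⁻¹ g₀)`, then invert `k`
          have h1 : ∀ k : ↥K, ∫ p, ψ g₀ (HaarHK.hkMap H K (p, k)) ∂μH =
              (μH.real {p : ↥H | (p : G) ∈ (K : Set G)}) * h (((k⁻¹ : ↥K) : G) * g₀) := by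
            intro k
            have : (fun p : ↥H => ψ g₀ (HaarHK.hkMap H K (p, k))) =
                fun p : ↥H => (K : Set G).indicator h ((p : G) * (((k⁻¹ : ↥K) : G) * g₀)) := by
              funext p
              simp only [hψ, HaarHK.hkMap_apply, Subgroup.coe_inv, mul_assoc]
            rw [this]
            exact integral_subgroup_indicator_mul_eq hH hKo hKc hHK μH h hmod g₀ _
          rw [show (fun k : ↥K => ∫ p, ψ g₀ (HaarHK.hkMap H K (p, k)) ∂μH) =
              fun k : ↥K => (fun k' : ↥K => (μH.real {p : ↥H | (p : G) ∈ (K : Set G)}) * h ((k' : G) * g₀)) k⁻¹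
              from funext h1]
          exact integral_inv_eq_self (fun k' : ↥K => (μH.real {p : ↥H | (p : G) ∈ (K : Set G)}) * h ((k' : G) * g₀)) μK
      _ = _ := by
          rw [integral_const_mul, hc, ENNReal.coe_toReal, Complex.real_smul]
  -- `∫_G ψ_g = ∫_G ψ_1` by right invariance
  have hinv : ∫ x, ψ g x ∂μG = ∫ x, ψ 1 x ∂μG := by
    have : (fun x => ψ g x) = fun x => ψ 1 (x * g) := by
      funext x; simp only [hψ, mul_one]
    rw [this]
    exact integral_mul_right_eq_self (fun x => ψ 1 x) g
  -- the constants are non-zero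
  have hC : (μH.real {p : ↥H | (p : G) ∈ (K : Set G)}) ≠ 0 := by
    have hopen : IsOpen {p : ↥H | (p : G) ∈ (K : Set G)} := hKo.preimage continuous_subtype_val
    have hcpt : IsCompact {p : ↥H | (p : G) ∈ (K : Set G)} := hH.isClosedEmbedding_subtypeVal.isCompact_preimage hKc
    rw [Measure.real, ENNReal.toReal_ne_zero]
    exact ⟨hopen.measure_ne_zero μH ⟨1, K.one_mem⟩, hcpt.measure_lt_top.ne⟩
  have hc' : (HaarHK.decompConst hH hKc hHK μG μH μK : ℝ) ≠ 0 :=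
    (NNReal.coe_pos.2 (HaarHK.decompConst_pos hH hKc hHK μG μH μK)).ne'
  rw [hformula, hformula] at hinv
  simp only [mul_one] at hinv
  have := mul_left_cancel₀ (Complex.ofReal_ne_zero.2 hc') hinv
  exact mul_left_cancel₀ (Complex.ofReal_ne_zero.2 hC) this


end Literature.NumberTheory.Automorphic

end
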